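import Mathlib
import Summits.CriticalPhenomena.CardyFormulaZ2.Theorems.CardySelfRefinementDefs
import Summits.CriticalPhenomena.CardyFormulaZ2.Theorems.CardySelfRefinementRussoDriftModel
import Summits.CriticalPhenomena.CardyFormulaZ2.Theorems.CardySelfRefinementTrivialSectorRateStubOrbitAlignmentConditioning
import Summits.CriticalPhenomena.CardyFormulaZ2.Theorems.CardySelfRefinementTrivialSectorRateStubFourArmAboveOneCircuitBitsLocality
import Literature.Probability.Percolation.RevealmentOrthogonality
import Literature.Probability.Percolation.BoundaryExplorerRevealment
import HarnessLib

/-!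
# Helper (M4a), part 4, of stub `stub_fourArmAboveOne`, line `far-field-is-a-quarter-turn`
(crux `TrivialSectorRate`, stmt-CriticalPhenomena-10266): (B.5) NON-PIVOTAL ALIGNED BLOCKS ARE
INVISIBLE TO A MEAN-ZERO BIT, for the dependent model `M_k`

Garban's (B.5) (Schramm–Smirnov 2011, App. B, proof of Lemma B.1: "conditioned on the event that
`Q_j` is not pivotal for `X`, `C_j` is independent of `X` and is such that its (conditional)
expectation is still `0`"; tree, for `P_p`: `integral_mul_bit_eq_integral_indicator_pivotal`,
`RevealmentOrthogonality.lean`) for the self-refinement law `M_k(ρ,c₀)` and a block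
`T = blockPairs j R` ALIGNED with the coarse lattice (`k ∣ j i ± R`):

* `M_integral_mul_eq_mul_integral_of_aligned` — `E[F(ω ∖ T) G(ω ∩ T)] = E[F(ω ∖ T)] E[G(ω ∩ T)]`
  for bounded measurable `F`, `G` (the decoupling identity `M_integral_eq_integral_integral` of
  file `…StubFourArmAboveOneCircuitBitsLocality.lean`);
* `M_integral_mul_bit_eq_integral_indicator_pivotal` (registered helper) — for `φ(obs ω T)` a
  mean-zero bit read off `T` and `f` bounded measurable,
  `∫ f · φ(obs T) dM_k = ∫ 1_{T pivotal for f} f · φ(obs T) dM_k`: off the pivotal event `f` is the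
  function `f(ω ∖ T)` of the edges off `T`, independent of the bit under `M_k` by alignment.

References: O. Schramm, S. Smirnov (app. C. Garban), Ann. Probab. 39 (2011), App. B, (B.5);
J. van den Berg, P. Nolin, Progr. Probab. 77 (2020), §5.2, (G-B4a).

Target file:
`Summits/CriticalPhenomena/CardyFormulaZ2/Theorems/CardySelfRefinementTrivialSectorRateStubFourArmAboveOneCircuitBitsPivotal.lean`.
-/

noncomputable section

namespace Summit.CriticalPhenomena.CardyFormulaZ2.Theorems.CardySelfRefinement.FarField

open Set MeasureTheory ProbabilityTheory
open Literature.Probability.LatticeModels Literature.Probability.Percolation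
open Literature.Probability.Percolation.QuadCrossing
open Summit.CriticalPhenomena.CardyFormulaZ2.Theses.CardySelfRefinement

/-! ### Functions of the inside and of the outside of an aligned block multiply in expectation -/

/-- **`E[F(ω ∖ T) G(ω ∩ T)] = E[F(ω ∖ T)] · E[G(ω ∩ T)]` under `M_k(ρ,c₀)`** for an aligned block
`T = blockPairs j R` (`k ∣ j i ± R`) and bounded measurable `F`, `G` (the decoupling identity
`M_integral_eq_integral_integral` applied to `Φ(x, y) = F(y) G(x)`). -/
theorem M_integral_mul_eq_mul_integral_of_aligned {k : ℕ} (hk : 0 < k) (ρ c₀ : ℝ) {j : Site 2} {R : ℕ}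
    (hal : ∀ i, (k : ℤ) ∣ j i - R ∧ (k : ℤ) ∣ j i + R) {F G : BondConfig (Site 2) → ℝ}
    (hFm : Measurable F) (hGm : Measurable G) {CF CG : ℝ} (hFC : ∀ ω, |F ω| ≤ CF) (hGC : ∀ ω, |G ω| ≤ CG) :
    ∫ ω, F (ω \ ↑(blockPairs j R)) * G (ω ∩ ↑(blockPairs j R)) ∂(M k ρ c₀) =
      (∫ ω, F (ω \ ↑(blockPairs j R)) ∂(M k ρ c₀)) * ∫ ω, G (ω ∩ ↑(blockPairs j R)) ∂(M k ρ c₀) := by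
  set T : Set (Sym2 (Site 2)) := ↑(blockPairs j R) with hT
  set Φ : BondConfig (Site 2) × BondConfig (Site 2) → ℝ := fun z => F z.2 * G z.1 with hΦ
  have hΦm : Measurable Φ := (hFm.comp measurable_snd).mul (hGm.comp measurable_fst)
  have hCF : 0 ≤ CF := (abs_nonneg _).trans (hFC ∅)
  have hΦC : ∀ z, |Φ z| ≤ CF * CG := fun z => by
    simp only [hΦ]
    rw [abs_mul]
    exact mul_le_mul (hFC _) (hGC _) (abs_nonneg _) hCF
  have h := M_integral_eq_integral_integral hk ρ c₀ hal hΦm hΦC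
  simp only [hΦ] at h
  rw [h]
  simp_rw [integral_const_mul]
  rw [integral_mul_const]

/-! ### (B.5) for `M_k` -/

/-- **(B.5) `E[f C] = E[f C ; T pivotal for f]` under `M_k`, for an aligned block** (registered
helper of the stub `stub_fourArmAboveOne`; the `M_k`-analogue of the tree's
`integral_mul_bit_eq_integral_indicator_pivotal`).  Let `T = blockPairs j R` be aligned with the
coarse lattice (`k ∣ j i ± R`), `φ (obs ω T)` a function of the configuration inside `T` of
`M_k(ρ,c₀)`-mean zero, and `f` bounded measurable.  Call `T` *pivotal for `f` at `ω`* if some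
modification of `ω` inside `T` changes the value of `f`.  Then only the pivotal event contributes
to `E[f · φ(obs T)]`: off it, `f` coincides with the function `f(ω ∖ T)` of the edges off `T`,
which is independent of the bit under `M_k` (`M_integral_mul_eq_mul_integral_of_aligned`). -/
theorem M_integral_mul_bit_eq_integral_indicator_pivotal {k : ℕ} (hk : 0 < k) (ρ c₀ : ℝ)
    {j : Site 2} {R : ℕ} (hal : ∀ i, (k : ℤ) ∣ j i - R ∧ (k : ℤ) ∣ j i + R)
    (φ : Finset (Sym2 (Site 2)) → ℝ) (h0 : ∫ ω, φ (obs ω (blockPairs j R)) ∂(M k ρ c₀) = 0)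
    {f : BondConfig (Site 2) → ℝ} (hfm : Measurable f) {K : ℝ} (hfK : ∀ ω, |f ω| ≤ K) :
    ∫ ω, f ω * φ (obs ω (blockPairs j R)) ∂(M k ρ c₀) =
      ∫ ω, {ω | ∃ ξ ⊆ (↑(blockPairs j R) : Set (Sym2 (Site 2))),
          f (ω \ ↑(blockPairs j R) ∪ ξ) ≠ f ω}.indicator f ω * φ (obs ω (blockPairs j R))
        ∂(M k ρ c₀) := by
  set B : Finset (Sym2 (Site 2)) := blockPairs j R with hBdef
  haveI := isProbabilityMeasure_M k ρ c₀
  let Pv : Set (BondConfig (Site 2)) := {ω | ∃ ξ ⊆ (↑B : Set (Sym2 (Site 2))), f (ω \ ↑B ∪ ξ) ≠ f ω}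
  let N : Set (BondConfig (Site 2)) := {ω | ∀ ξ ⊆ (↑B : Set (Sym2 (Site 2))), f (ω \ ↑B ∪ ξ) = f ω}
  have hNPv : ∀ ω, ω ∈ N ↔ ω ∉ Pv := fun ω => by simp [N, Pv]
  -- measurability of the non-pivotal event (finitely many modifications)
  have hmod : ∀ ξ : Set (Sym2 (Site 2)), Measurable fun ω : BondConfig (Site 2) => ω \ ↑B ∪ ξ := fun ξ =>
    measurable_set_iff.2 fun e =>
      ((measurable_set_mem e).and measurable_const).or measurable_const
  have hNm : MeasurableSet N := by
    have hNeq : N = ⋂ ξ ∈ B.powerset, {ω | f (ω \ ↑B ∪ ↑ξ) = f ω} := by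
      ext ω
      simp only [N, Set.mem_setOf_eq, Set.mem_iInter, Finset.mem_powerset]
      constructor
      · intro h ξ hξ; exact h _ (Finset.coe_subset.2 hξ)
      · intro h ξ hξ
        have hfin : ξ.Finite := B.finite_toSet.subset hξ
        have h' := h hfin.toFinset (by intro e he; exact hξ (hfin.mem_toFinset.1 he))
        rwa [hfin.coe_toFinset] at h'
    rw [hNeq]
    exact MeasurableSet.biInter (Finset.countable_toSet _) fun ξ _ =>
      measurableSet_eq_fun (hfm.comp (hmod _)) hfm
  -- `N` only depends on the edges off `B`: `ω ∈ N ↔ ω ∖ B ∈ N`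
  have hNsdiff : ∀ ω : BondConfig (Site 2), ω ∈ N ↔ ω \ ↑B ∈ N := by
    intro ω
    have hdd : (ω \ ↑B) \ ↑B = ω \ ↑B := by rw [Set.sdiff_sdiff, Set.union_self]
    constructor
    · intro hω ξ hξ
      show f ((ω \ ↑B) \ ↑B ∪ ξ) = f (ω \ ↑B)
      rw [hdd, hω ξ hξ]
      have h' := hω ∅ (Set.empty_subset _)
      rw [Set.union_empty] at h'
      exact h'.symm
    · intro hω ξ hξ
      have h1 : f ((ω \ ↑B) \ ↑B ∪ ξ) = f (ω \ ↑B) := hω ξ hξ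
      have h2 : f ((ω \ ↑B) \ ↑B ∪ (ω ∩ ↑B)) = f (ω \ ↑B) := hω _ Set.inter_subset_right
      rw [hdd] at h1 h2
      rw [Set.sdiff_union_inter] at h2
      rw [h1, ← h2]
  -- split `f = 1_{Pv} f + 1_N f` and show the `N` part integrates to zero against the bit
  have hbit := measurable_comp_obs B φ
  let K' : ℝ := |K| * ∑ o ∈ B.powerset, |φ o|
  have hprodK : ∀ ω, ‖f ω * φ (obs ω B)‖ ≤ K' := fun ω => by
    rw [Real.norm_eq_abs, abs_mul]
    exact mul_le_mul ((hfK ω).trans (le_abs_self K)) (abs_comp_obs_le B φ ω) (abs_nonneg _)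
      (abs_nonneg _)
  have hfi : Integrable (fun ω => f ω * φ (obs ω B)) (M k ρ c₀) :=
    Integrable.of_bound (hfm.mul hbit).aestronglyMeasurable K' (ae_of_all _ hprodK)
  have hsplit : ∀ ω, f ω * φ (obs ω B) =
      Pv.indicator f ω * φ (obs ω B) + N.indicator (fun ω => f ω * φ (obs ω B)) ω := by
    intro ω
    by_cases hω : ω ∈ Pv
    · rw [Set.indicator_of_mem hω, Set.indicator_of_notMem (fun h => (hNPv ω).1 h hω), add_zero]
    · rw [Set.indicator_of_notMem hω, Set.indicator_of_mem ((hNPv ω).2 hω), zero_mul, zero_add]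
  have hNi : Integrable (N.indicator fun ω => f ω * φ (obs ω B)) (M k ρ c₀) := hfi.indicator hNm
  have hPi : Integrable (fun ω => Pv.indicator f ω * φ (obs ω B)) (M k ρ c₀) := by
    have heq : (fun ω => Pv.indicator f ω * φ (obs ω B)) =
        fun ω => f ω * φ (obs ω B) - N.indicator (fun ω => f ω * φ (obs ω B)) ω := by
      funext ω; rw [hsplit ω]; ring
    rw [heq]; exact hfi.sub hNi
  rw [integral_congr_ae (ae_of_all _ hsplit), integral_add hPi hNi]
  suffices hzero : ∫ ω, N.indicator (fun ω => f ω * φ (obs ω B)) ω ∂(M k ρ c₀) = 0 by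
    rw [hzero, add_zero]
  -- on `N`, `f ω = f (ω ∖ B)`; the bit is a function of `ω ∩ B`
  have hobs : ∀ ω : BondConfig (Site 2), obs ω B = obs (ω ∩ ↑B) B := fun ω =>
    obs_congr fun e he => by simp [he]
  have hind : ∀ ω, N.indicator (fun ω => f ω * φ (obs ω B)) ω =
      (N.indicator (1 : BondConfig (Site 2) → ℝ) (ω \ ↑B) * f (ω \ ↑B)) * φ (obs (ω ∩ ↑B) B) := by
    intro ω
    rw [← hobs ω]
    by_cases hω : ω ∈ N
    · have h' := hω ∅ (Set.empty_subset _)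
      rw [Set.union_empty] at h'
      rw [Set.indicator_of_mem hω, Set.indicator_of_mem ((hNsdiff ω).1 hω), Pi.one_apply, one_mul, h']
    · rw [Set.indicator_of_notMem hω, Set.indicator_of_notMem (fun h => hω ((hNsdiff ω).2 h)),
        zero_mul, zero_mul]
  simp_rw [hind]
  have hFm : Measurable fun ω : BondConfig (Site 2) => N.indicator (1 : BondConfig (Site 2) → ℝ) ω * f ω :=
    (measurable_one.indicator hNm).mul hfm
  have hFC : ∀ ω : BondConfig (Site 2), |N.indicator (1 : BondConfig (Site 2) → ℝ) ω * f ω| ≤ K := fun ω => by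
    rw [abs_mul]
    by_cases hω : ω ∈ N
    · rw [Set.indicator_of_mem hω, Pi.one_apply, abs_one, one_mul]; exact hfK ω
    · rw [Set.indicator_of_notMem hω, abs_zero, zero_mul]; exact (abs_nonneg _).trans (hfK ω)
  calc ∫ ω, N.indicator (1 : BondConfig (Site 2) → ℝ) (ω \ ↑B) * f (ω \ ↑B) * φ (obs (ω ∩ ↑B) B) ∂(M k ρ c₀)
      = (∫ ω, N.indicator (1 : BondConfig (Site 2) → ℝ) (ω \ ↑B) * f (ω \ ↑B) ∂(M k ρ c₀)) *
          ∫ ω, φ (obs (ω ∩ ↑B) B) ∂(M k ρ c₀) :=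
        M_integral_mul_eq_mul_integral_of_aligned hk ρ c₀ hal (F := fun ω => N.indicator 1 ω * f ω)
          (G := fun ω => φ (obs ω B)) hFm hbit hFC (abs_comp_obs_le B φ)
    _ = 0 := by
        rw [show (∫ ω, φ (obs (ω ∩ ↑B) B) ∂(M k ρ c₀)) = ∫ ω, φ (obs ω B) ∂(M k ρ c₀) from
          integral_congr_ae (ae_of_all _ fun ω => by simp only [← hobs]), h0, mul_zero]

end Summit.CriticalPhenomena.CardyFormulaZ2.Theorems.CardySelfRefinement.FarField

end
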